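import Summits.QuantumFields.YangMills.Theorems.UnitScaleTiltProp7SectET3DeltaPiT3PInv
import Summits.QuantumFields.YangMills.Theorems.UnitScaleTiltProp7SectET3DeltaOneT3JTerm
import HarnessLib

/-!
# Route `UnitScaleTilt`, crux «MinimiserStabilityRegPr» (stmt-QuantumFields-19200, stub EX) ∕ (O″χ) B0 (stmt-QuantumFields-20520), node N06(d = 3), route (α) —
# DEFINITIONS FILE, LAYER 0 BRICK L0b PART 3′∕4′ «PINV TWIN, Δ₁ SIBLING» (P0′ of the (C2′) cascade; ★★OWNER RULING g28-№4 AMENDED + EX namer SLOT WORD 20:48:46Z ∕ 21:02:32Z):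
# **PRINT'S `Δ₁ = Pᵀ(Δ^η + T_J)P` ([Balaban1985BackgroundPropagators] (3.127)–(3.128)) AT THE PINV LETTERS** — the slot letter `DeltaOneP (T_J) := Pᴾᵀ(Δ^η + T_J)Pᴾ` over ✓p667715's
# `gaugeCorrP`, the J-term RE-LETTERED on `H46P` (`H46LP`, `tjFormP`, `tjSesqP`, `TJP`, `TJSlotP` = ✓`…DeltaOneT3JTerm`'s texts with `H46P` for `H46`, since ✓`TJ` sits on ✓`H46` = the
# junk-`G′` slot), `DeltaOnePJ := DeltaOneP TJSlotP` (the `Δ₁` of record for `𝒢f`∕`H₁f`), `DeltaOneP_zero : DeltaOneP 0 = DeltaPiSlotP`, and the three EX slot rows for ANY `T_J`, UNCONDITIONAL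

Cell `ym3-torus` (HUMAN RULING D-0037, YM ladder rung R3 — YM₃ on T³, NOT d = 4, NOT Clay; YM gap NOT proved).  Bytes: width seat `ym3-torus-px16` (gen 2, «px16: P0′ BYTES GO»); filing hand:
EX knit namer ★w2-19200 g6 (prover Defs rule, `--kind definition --supports stmt-QuantumFields-19200 --as helper`).  HONESTY CLAUSE + KILL CRITERION of (C2′) as in ✓p667715's docstring
(the `Pᴾ` inside is the pinv letter; `hPos₁ : RegPr (α L) U₀ → PosOnto …(DeltaOnePJ) U₀` reads «[B9] Thm 3.11 + `‖G‖·‖T_J‖ < 1` (p. 421), transported to the pinv letter modulo the finite-rank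
bookkeeping»).  THE PRINT: p. 421 (3.127)–(3.130) *«Δ₁ … G₁ … H₁ = G₁Q*(QG₁Q*)⁻¹ … for J = 0 we get the operators of Sect. … (G₀ = G)»*; [Balaban1985Variational] (110) p.294 «we take the
operators H₁, 𝔓 defined by the operator Δ₁».

WHAT IS DEFINED: `DeltaOneP (TJ)`, `H46LP`, `tjFormP`, `tjSesqP`, `TJP`, `TJSlotP`, `DeltaOnePJ`.  WHAT IS PROVED (def-unfoldings + the rows; all for `0 ≤ a`, EVERY `U₀`, ANY `T_J` — no
J-term hypothesis is needed because `Pᴾ(Dλ) = 0` kills the whole sandwich, exactly as ✓`DeltaOne_DL2_of_mem_NS`): `DeltaOneP_apply`, `inner_DeltaOneP`, ★`DeltaOneP_zero`,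
★★★`DeltaOneP_DL2_of_mem_NS`, ★★★`DeltaOneP_kills_NS`, ★★★`inner_DL2_DeltaOneP_eq_zero` (the texts of ✓`DeltaOne_DL2_of_mem_NS`∕✓`DeltaOne_kills_NS`∕✓`inner_DL2_DeltaOne_eq_zero` with
`(ha : 0 ≤ a)` for the empty `(hq : PosPrime …)`).
HONEST SCOPE.  Definitions + linear algebra; NO estimate; the `T_J`-SPECIFIC size rows (✓`…JTermRows`∕`TJ_rows_at_regPr` twins at `H46P`) and the reality∕trace slot rows are P3∕sequel; not a
proof of any stub; nothing continuum ∕ OS ∕ mass-gap ∕ Clay.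

References: T. Bałaban, CMP **99** (1985) 389–434 [Balaban1985BackgroundPropagators] ((3.119) p.419, (3.124) p.420, (3.126)–(3.130) pp.420–421); CMP **102** (1985) 277–309
[Balaban1985Variational] ((110) p.294).
-/

set_option autoImplicit false

noncomputable section

open scoped InnerProductSpace ComplexConjugate Matrix.Norms.L2Operator

namespace Summit.QuantumFields.YangMills.Theorems.Prop7SectET3DeltaOnePInv

open Literature.MathematicalPhysics.QuantumFieldTheory.Balaban1983to89
open Literature.MathematicalPhysics.QuantumFieldTheory.Balaban1983to89.T3ContinuumYM3Torus
open T3SectALandauChart (eta)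
open B9SectCLatticeCarrier (Bond)
open B9Eq311L2Pairing (WL2)
open B11Eq103H1Complex (SiteL2K BondL2K)
open Summit.QuantumFields.YangMills.Theorems.Prop7SectET3Transport (periodsT3)
open Summit.QuantumFields.YangMills.Theorems.Prop7SectET3HilbertLetters (W₂ toL2 toL2B DL2 DstarL2)
open Summit.QuantumFields.YangMills.Theorems.Prop7SectET3GaugeProjector (NS RS)
open Summit.QuantumFields.YangMills.Theorems.Prop7SectET3WilsonHessian (DeltaEta toL2CLM)
open Summit.QuantumFields.YangMills.Theorems.Prop7SectET3DeltaOne (actionGrad avgHess)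
open Summit.QuantumFields.YangMills.Theorems.Prop7SectET3DeltaPiPInv (gaugeCorrP DeltaPiSlotP H46P gaugeCorrP_DL2_of_mem_NS)

variable {F : T3Family} {n K : ℕ} {h : n ≤ K} {c₀ cB a : ℝ} [Fact (0 < c₀)] [Fact (0 < cB)]

/-! ## §1 `Δ₁ᴾ(T_J)` as a slot letter, the J-term at `H46P`, `DeltaOnePJ` -/

section DeltaOneP

variable (F n K h c₀ cB a)
variable (TJ : GaugeField (F.P K) 0 (Matrix.specialUnitaryGroup (Fin 2) ℂ) → (BondL2K ℂ 3 (periodsT3 F K) c₀ W₂ →ₗ[ℂ] BondL2K ℂ 3 (periodsT3 F K) c₀ W₂))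

/-- **PRINT'S `Δ₁(U₀)` OF (3.127)–(3.128) WITH THE J-TERM AS A SLOT, AT THE PINV LETTER: `U₀ ↦ Pᴾᵀ(Δ^η_{U₀} + T_J(U₀))Pᴾ`** (twin of ✓`Prop7SectET3DeltaOne.DeltaOne`).
[cite: Balaban1985BackgroundPropagators, (3.127)–(3.128) p.421, (3.119) p.419] -/
def DeltaOneP : GaugeField (F.P K) 0 (Matrix.specialUnitaryGroup (Fin 2) ℂ) → (BondL2K ℂ 3 (periodsT3 F K) c₀ W₂ →ₗ[ℂ] BondL2K ℂ 3 (periodsT3 F K) c₀ W₂) :=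
  fun U₀ => LinearMap.adjoint (gaugeCorrP F n K h c₀ cB a U₀) ∘ₗ
    ((DeltaEta F n K c₀ U₀ : BondL2K ℂ 3 (periodsT3 F K) c₀ W₂ →ₗ[ℂ] BondL2K ℂ 3 (periodsT3 F K) c₀ W₂) + TJ U₀) ∘ₗ gaugeCorrP F n K h c₀ cB a U₀

/-- Print's `H(U₀)` of (3.126) AT THE PINV SLOT on the route carriers (`H46P`) as a CONTINUOUS linear map (twin of ✓`H46L`). [cite: Balaban1985BackgroundPropagators, (3.126) p.420] -/
def H46LP (U₀ : GaugeField (F.P K) 0 (Matrix.specialUnitaryGroup (Fin 2) ℂ)) : (PBond (F.P n) 0 → Matrix (Fin 2) (Fin 2) ℂ) →L[ℂ] (PBond (F.P K) 0 → Matrix (Fin 2) (Fin 2) ℂ) :=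
  LinearMap.toContinuousLinearMap (H46P F n K h c₀ cB a U₀)

/-- Print's J-term as a bilinear form on the exponent fields, AT THE PINV LETTER: `t_J[X, Y] := −actionGrad (H46P (avgHess X Y))` (twin of ✓`tjForm`). [cite: Balaban1985BackgroundPropagators, (3.127) p.421] -/
def tjFormP (U₀ : GaugeField (F.P K) 0 (Matrix.specialUnitaryGroup (Fin 2) ℂ)) :
    (PBond (F.P K) 0 → Matrix (Fin 2) (Fin 2) ℂ) →L[ℂ] (PBond (F.P K) 0 → Matrix (Fin 2) (Fin 2) ℂ) →L[ℂ] ℂ :=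
  -((ContinuousLinearMap.compL ℂ (PBond (F.P K) 0 → Matrix (Fin 2) (Fin 2) ℂ) (PBond (F.P n) 0 → Matrix (Fin 2) (Fin 2) ℂ) ℂ
      ((actionGrad F K U₀).comp (H46LP F n K h c₀ cB a U₀))).comp (avgHess F n K h U₀))

/-- The J-term as a bounded sesquilinear form on `L²`, print's normalisation, AT THE PINV LETTER (twin of ✓`tjSesq`). [cite: Balaban1985BackgroundPropagators, (3.127) p.421, (3.11)–(3.12) p.392] -/
def tjSesqP (U₀ : GaugeField (F.P K) 0 (Matrix.specialUnitaryGroup (Fin 2) ℂ)) :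
    BondL2K ℂ 3 (periodsT3 F K) c₀ W₂ →L⋆[ℂ] BondL2K ℂ 3 (periodsT3 F K) c₀ W₂ →L[ℂ] ℂ :=
  ((-(2 * (c₀ : ℂ)) / (((eta F n K : ℝ) : ℂ)) ^ 2) •
    ((ContinuousLinearMap.compL ℂ (BondL2K ℂ 3 (periodsT3 F K) c₀ W₂) (PBond (F.P K) 0 → Matrix (Fin 2) (Fin 2) ℂ) ℂ).flip (toL2CLM F K c₀))).comp
      ((tjFormP F n K h c₀ cB a U₀).comp
        (((starL ℂ : (PBond (F.P K) 0 → Matrix (Fin 2) (Fin 2) ℂ) ≃L⋆[ℂ] (PBond (F.P K) 0 → Matrix (Fin 2) (Fin 2) ℂ)) :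
            (PBond (F.P K) 0 → Matrix (Fin 2) (Fin 2) ℂ) →L⋆[ℂ] (PBond (F.P K) 0 → Matrix (Fin 2) (Fin 2) ℂ)).comp
          (toL2CLM F K c₀)))

/-- **PRINT'S J-TERM OPERATOR `T_J(U₀)` AT THE PINV LETTER** (the operator of `tjSesqP U₀`; twin of ✓`TJ`). [cite: Balaban1985BackgroundPropagators, (3.127)–(3.128) p.421] -/
def TJP (U₀ : GaugeField (F.P K) 0 (Matrix.specialUnitaryGroup (Fin 2) ℂ)) : BondL2K ℂ 3 (periodsT3 F K) c₀ W₂ →L[ℂ] BondL2K ℂ 3 (periodsT3 F K) c₀ W₂ :=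
  InnerProductSpace.continuousLinearMapOfBilin (tjSesqP F n K h c₀ cB a U₀)

/-- The J-term at the pinv letter in the slot type (twin of ✓`TJSlot`). [cite: Balaban1985BackgroundPropagators, (3.128) p.421] -/
def TJSlotP : GaugeField (F.P K) 0 (Matrix.specialUnitaryGroup (Fin 2) ℂ) → (BondL2K ℂ 3 (periodsT3 F K) c₀ W₂ →ₗ[ℂ] BondL2K ℂ 3 (periodsT3 F K) c₀ W₂) :=
  fun U₀ => (TJP F n K h c₀ cB a U₀ : BondL2K ℂ 3 (periodsT3 F K) c₀ W₂ →ₗ[ℂ] BondL2K ℂ 3 (periodsT3 F K) c₀ W₂)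

/-- ★★ **`Δ₁` OF RECORD AT THE PINV LETTERS: `DeltaOnePJ := DeltaOneP TJSlotP`** (print's `Δ₁ = Pᵀ(Δ^η + T_J)P` with both `P` and the `H` inside `T_J` at the pinv letter; twin of ✓`DeltaOneJ`).
[cite: Balaban1985BackgroundPropagators, (3.127)–(3.128) p.421] -/
def DeltaOnePJ : GaugeField (F.P K) 0 (Matrix.specialUnitaryGroup (Fin 2) ℂ) → (BondL2K ℂ 3 (periodsT3 F K) c₀ W₂ →ₗ[ℂ] BondL2K ℂ 3 (periodsT3 F K) c₀ W₂) :=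
  DeltaOneP F n K h c₀ cB a (TJSlotP F n K h c₀ cB a)

variable {F n K h c₀ cB a}

/-- Unfolding `Δ₁ᴾ = Pᴾᵀ(Δ^η + T_J)Pᴾ`. [cite: Balaban1985BackgroundPropagators, (3.128) p.421] -/
theorem DeltaOneP_apply (U₀ : GaugeField (F.P K) 0 (Matrix.specialUnitaryGroup (Fin 2) ℂ)) (A : BondL2K ℂ 3 (periodsT3 F K) c₀ W₂) :
    DeltaOneP F n K h c₀ cB a TJ U₀ A =
      LinearMap.adjoint (gaugeCorrP F n K h c₀ cB a U₀) (DeltaEta F n K c₀ U₀ (gaugeCorrP F n K h c₀ cB a U₀ A) + TJ U₀ (gaugeCorrP F n K h c₀ cB a U₀ A)) := rfl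

/-- **(3.128) AS A FORM at the pinv letter: `⟪A′, Δ₁ᴾA⟫ = ⟪PᴾA′, Δ^η(PᴾA)⟫ + ⟪PᴾA′, T_J(PᴾA)⟫`.** [cite: Balaban1985BackgroundPropagators, (3.127)–(3.128) p.421] -/
theorem inner_DeltaOneP (U₀ : GaugeField (F.P K) 0 (Matrix.specialUnitaryGroup (Fin 2) ℂ)) (A' A : BondL2K ℂ 3 (periodsT3 F K) c₀ W₂) :
    ⟪A', DeltaOneP F n K h c₀ cB a TJ U₀ A⟫_ℂ =
      ⟪gaugeCorrP F n K h c₀ cB a U₀ A', DeltaEta F n K c₀ U₀ (gaugeCorrP F n K h c₀ cB a U₀ A)⟫_ℂ + ⟪gaugeCorrP F n K h c₀ cB a U₀ A', TJ U₀ (gaugeCorrP F n K h c₀ cB a U₀ A)⟫_ℂ := by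
  rw [DeltaOneP_apply, LinearMap.adjoint_inner_right, inner_add_right]

/-- **`T_J := 0` GIVES BACK `Δ_πᴾ`**: `DeltaOneP 0 = DeltaPiSlotP` (twin of ✓`DeltaOne_zero`). [cite: Balaban1985BackgroundPropagators, (3.130) p.421] -/
theorem DeltaOneP_zero : DeltaOneP F n K h c₀ cB a (fun _ => 0) = DeltaPiSlotP F n K h c₀ cB a := by
  funext U₀
  rw [DeltaOneP, add_zero]
  rfl

/-- ★★★ **`Δ₁ᴾ(D_{U₀}λ) = 0` FOR `λ ∈ N_S(U₀)`, ANY `T_J`, `0 ≤ a`** (`Pᴾ(Dλ) = 0`; twin of ✓`DeltaOne_DL2_of_mem_NS`, unconditional). [cite: Balaban1985BackgroundPropagators, (3.119) p.419, (3.128) p.421] -/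
theorem DeltaOneP_DL2_of_mem_NS (ha : 0 ≤ a) {U₀ : GaugeField (F.P K) 0 (Matrix.specialUnitaryGroup (Fin 2) ℂ)} {l : SiteL2K ℂ 3 (periodsT3 F K) c₀ W₂}
    (hl : l ∈ NS F n K h c₀ cB U₀) : DeltaOneP F n K h c₀ cB a TJ U₀ (DL2 F n K c₀ U₀ l) = 0 := by
  rw [DeltaOneP_apply, gaugeCorrP_DL2_of_mem_NS ha hl, map_zero, map_zero, add_zero, map_zero]

/-- ★★★ **THE HYPOTHESIS `hΔ` OF THE (3.124) ROWS, DISCHARGED FOR `Δx := DeltaOneP TJ` AT EVERY BACKGROUND** (twin of ✓`DeltaOne_kills_NS`). [cite: Balaban1985BackgroundPropagators, (3.124) p.420, (3.128) p.421] -/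
theorem DeltaOneP_kills_NS (ha : 0 ≤ a) {U₀ : GaugeField (F.P K) 0 (Matrix.specialUnitaryGroup (Fin 2) ℂ)} :
    ∀ l ∈ NS F n K h c₀ cB U₀, DeltaOneP F n K h c₀ cB a TJ U₀ (DL2 F n K c₀ U₀ l) = 0 :=
  fun _ hl => DeltaOneP_DL2_of_mem_NS TJ ha hl

/-- ★★★ **THE HYPOTHESIS `hΔ′` OF THE LANDAU ROWS FOR `Δx := DeltaOneP TJ`: `⟪Dλ, Δ₁ᴾw⟫ = 0` on `N_S`** (twin of ✓`inner_DL2_DeltaOne_eq_zero`, unconditional). [cite: Balaban1985BackgroundPropagators, (3.119) p.419, (3.128) p.421] -/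
theorem inner_DL2_DeltaOneP_eq_zero (ha : 0 ≤ a) {U₀ : GaugeField (F.P K) 0 (Matrix.specialUnitaryGroup (Fin 2) ℂ)} :
    ∀ l ∈ NS F n K h c₀ cB U₀, ∀ w, ⟪DL2 F n K c₀ U₀ l, DeltaOneP F n K h c₀ cB a TJ U₀ w⟫_ℂ = 0 := by
  intro l hl w
  rw [inner_DeltaOneP, gaugeCorrP_DL2_of_mem_NS ha hl, inner_zero_left, inner_zero_left, add_zero]

end DeltaOneP


end Summit.QuantumFields.YangMills.Theorems.Prop7SectET3DeltaOnePInv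

end
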